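import Mathlib
import Summits.Ventures.PercRepro2.SeriesHMF
import Summits.Ventures.PercRepro2.HMFSureEdge

/-!
# The series CONTRACTION: an unmarked vertex of degree two is replaced by one edge (blind cell
PercRepro2, night-1 g15; NIGHT1-G15.md §4 — the Lean form of the S3 (1) «skeleton reduction»)

Let the unmarked vertex `v` carry exactly `f = {v, w}` and `f' = {v, w'}`.  `SeriesHMF` made `f'`
sure at no cost (`HMF_series_iff`).  Here a SURE edge `f'` lets `f` be re-ended from `v` to `w'`
(`ends' := ends[f ↦ {w, w'}]`): on `{f' open}` the connections among the vertices other than `v`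
agree in `ends` and `ends'` (`conn_reend_iff`, two closure arguments), hence so do the marked
events, the cluster of `a₃` and the residual events of `X̂` (`connDelEvent_reend_inter_open`).  The
mass-level consequences (`HMFc_reend_of_sure`, `HMF_series_contract`, …) are in `SeriesContractHMF`.
-/

open scoped Classical

namespace Summit.Ventures.PercRepro2

open UnionCluster CovForm PendantRoot

namespace SeriesCollapse

section Reend

variable {V : Type*} {E : Type*} [DecidableEq E] {ends : E → Sym2 V} {v w w' : V} {f f' : E}

/-- With `f` closed, re-ending `f` does not change the open graph. -/
lemma openGraph_update_of_closed {ω : Config E} (hω : ω f = false) (s : Sym2 V) :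
    openGraph (Function.update ends f s) ω = openGraph ends ω := by
  ext x y
  simp only [openGraph_adj]
  constructor
  · rintro ⟨hne, e, he, hends⟩
    have hef : e ≠ f := fun h => by rw [h, hω] at he; exact Bool.false_ne_true he
    exact ⟨hne, e, he, by rwa [Function.update_of_ne hef] at hends⟩
  · rintro ⟨hne, e, he, hends⟩
    have hef : e ≠ f := fun h => by rw [h, hω] at he; exact Bool.false_ne_true he
    exact ⟨hne, e, he, by rwa [Function.update_of_ne hef]⟩

/-- With `f` closed, re-ending `f` does not change any connection. -/
lemma conn_update_of_closed {ω : Config E} (hω : ω f = false) (s : Sym2 V) (x y : V) :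
    Conn (Function.update ends f s) ω x y ↔ Conn ends ω x y := by
  unfold Conn
  rw [openGraph_update_of_closed hω s]

/-- **Re-ending across a sure edge, forward.** With `f'` open, a connection in `ends` among vertices
other than `v` is a connection in `ends[f ↦ {w, w'}]`. -/
lemma conn_reend_of_conn {ω : Config E} (hf : ends f = s(v, w))
    (hf' : ends f' = s(v, w')) (hdeg : ∀ e, v ∈ ends e → e = f ∨ e = f') (hvw : v ≠ w)
    (hvw' : v ≠ w') {x y : V} (hx : x ≠ v) (hy : y ≠ v)
    (h : Conn ends ω x y) : Conn (Function.update ends f s(w, w')) ω x y := by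
  set ends' := Function.update ends f s(w, w') with hends'
  have hfe : ends' f = s(w, w') := by rw [hends', Function.update_self]
  let S : Set V := {z | (z ≠ v ∧ Conn ends' ω x z) ∨ (z = v ∧ Conn ends' ω x w')}
  have hS : ∀ z ∈ S, ∀ z', (openGraph ends ω).Adj z z' → z' ∈ S := by
    intro z hz z' hzz'
    obtain ⟨hne, e, he, hends⟩ := openGraph_adj.1 hzz'
    by_cases hef : e = f
    · rw [hef] at he hends
      rw [hf, Sym2.eq_iff] at hends
      rcases hends with ⟨hzv, hz'w⟩ | ⟨hz'v, hzw⟩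
      · -- `z = v`, `z' = w`: from `x ↔ w'` in `ends'` through the re-ended `f = {w, w'}`
        have hxw' : Conn ends' ω x w' := by
          rcases hz with ⟨hzv', _⟩ | ⟨_, h⟩
          · exact absurd hzv.symm hzv'
          · exact h
        rw [← hz'w]
        exact Or.inl ⟨hvw.symm,
          conn_trans hxw' (conn_of_openAdj ⟨f, he, by rw [hfe, Sym2.eq_swap]⟩)⟩
      · -- `z = w`, `z' = v`
        have hxw : Conn ends' ω x w := by
          rcases hz with ⟨_, h⟩ | ⟨hzv', _⟩
          · rw [hzw]; exact h
          · exact absurd (hzv'.trans hz'v) hne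
        rw [← hz'v]
        exact Or.inr ⟨rfl, conn_trans hxw (conn_of_openAdj ⟨f, he, hfe⟩)⟩
    · by_cases hef' : e = f'
      · rw [hef'] at he hends
        rw [hf', Sym2.eq_iff] at hends
        rcases hends with ⟨hzv, hz'w'⟩ | ⟨hz'v, hzw'⟩
        · have hxw' : Conn ends' ω x w' := by
            rcases hz with ⟨hzv', _⟩ | ⟨_, h⟩
            · exact absurd hzv.symm hzv'
            · exact h
          rw [← hz'w']
          exact Or.inl ⟨hvw'.symm, hxw'⟩
        · have hxw' : Conn ends' ω x w' := by
            rcases hz with ⟨_, h⟩ | ⟨hzv', _⟩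
            · rw [hzw']; exact h
            · exact absurd (hzv'.trans hz'v) hne
          rw [← hz'v]
          exact Or.inr ⟨rfl, hxw'⟩
      · -- the edge is neither `f` nor `f'`: it avoids `v`
        have hzv : z ≠ v := by
          rintro rfl
          rcases hdeg e (by rw [hends]; exact Sym2.mem_mk_left z z') with h | h
          · exact hef h
          · exact hef' h
        have hz'v : z' ≠ v := by
          rintro rfl
          rcases hdeg e (by rw [hends]; exact Sym2.mem_mk_right z z') with h | h
          · exact hef h
          · exact hef' h
        have hxz : Conn ends' ω x z := by
          rcases hz with ⟨_, h⟩ | ⟨hzv', _⟩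
          · exact h
          · exact absurd hzv' hzv
        have hends2 : ends' e = s(z, z') := by rw [hends', Function.update_of_ne hef, hends]
        exact Or.inl ⟨hz'v, conn_trans hxz (conn_of_openAdj ⟨e, he, hends2⟩)⟩
  have hxS : x ∈ S := Or.inl ⟨hx, conn_refl ends' ω x⟩
  rcases mem_of_conn_of_closed hS hxS h with ⟨_, h⟩ | ⟨hyv, _⟩
  · exact h
  · exact absurd hyv hy

/-- **Re-ending across a sure edge, backward.** -/
lemma conn_of_conn_reend {ω : Config E} (hf : ends f = s(v, w))
    (hf' : ends f' = s(v, w')) (hdeg : ∀ e, v ∈ ends e → e = f ∨ e = f') (hvw : v ≠ w)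
    (hvw' : v ≠ w') (hω : ω f' = true) {x y : V} (hx : x ≠ v) (hy : y ≠ v)
    (h : Conn (Function.update ends f s(w, w')) ω x y) : Conn ends ω x y := by
  set ends' := Function.update ends f s(w, w') with hends'
  have hfe : ends' f = s(w, w') := by rw [hends', Function.update_self]
  -- in `ends`, with `f'` open, `v ↔ w'`
  have hvw'c : Conn ends ω v w' := conn_of_openAdj ⟨f', hω, hf'⟩
  let S : Set V := {z | (z ≠ v ∧ Conn ends ω x z) ∨ (z = v ∧ Conn ends ω x w')}
  have hS : ∀ z ∈ S, ∀ z', (openGraph ends' ω).Adj z z' → z' ∈ S := by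
    intro z hz z' hzz'
    obtain ⟨hne, e, he, hends⟩ := openGraph_adj.1 hzz'
    by_cases hef : e = f
    · rw [hef] at he hends
      rw [hfe, Sym2.eq_iff] at hends
      -- `f` open: in `ends`, `w ↔ v` by `f` and `v ↔ w'` by `f'`
      have hwv : Conn ends ω w v := conn_of_openAdj ⟨f, he, by rw [hf, Sym2.eq_swap]⟩
      rcases hends with ⟨hzw, hz'w'⟩ | ⟨hz'w, hzw'⟩
      · -- `z = w`, `z' = w'`
        have hxw : Conn ends ω x w := by
          rcases hz with ⟨_, h⟩ | ⟨hzv, _⟩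
          · rw [hzw]; exact h
          · exact absurd (hzw.trans hzv).symm hvw
        rw [← hz'w']
        exact Or.inl ⟨hvw'.symm, conn_trans (conn_trans hxw hwv) hvw'c⟩
      · -- `z = w'`, `z' = w`
        have hxw' : Conn ends ω x w' := by
          rcases hz with ⟨_, h⟩ | ⟨hzv, _⟩
          · rw [hzw']; exact h
          · exact absurd (hzw'.trans hzv).symm hvw'
        rw [← hz'w]
        exact Or.inl ⟨hvw.symm, conn_trans (conn_trans hxw' (conn_symm hvw'c)) (conn_symm hwv)⟩
    · have hends1 : ends e = s(z, z') := by
        rw [hends', Function.update_of_ne hef] at hends; exact hends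
      by_cases hef' : e = f'
      · rw [hef'] at he hends1
        rw [hf', Sym2.eq_iff] at hends1
        rcases hends1 with ⟨hzv, hz'w'⟩ | ⟨hz'v, hzw'⟩
        · have hxw' : Conn ends ω x w' := by
            rcases hz with ⟨hzv', _⟩ | ⟨_, h⟩
            · exact absurd hzv.symm hzv'
            · exact h
          rw [← hz'w']
          exact Or.inl ⟨hvw'.symm, hxw'⟩
        · have hxw' : Conn ends ω x w' := by
            rcases hz with ⟨_, h⟩ | ⟨hzv', _⟩
            · rw [hzw']; exact h
            · exact absurd (hzv'.trans hz'v) hne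
          rw [← hz'v]
          exact Or.inr ⟨rfl, hxw'⟩
      · have hzv : z ≠ v := by
          rintro rfl
          rcases hdeg e (by rw [hends1]; exact Sym2.mem_mk_left z z') with h | h
          · exact hef h
          · exact hef' h
        have hz'v : z' ≠ v := by
          rintro rfl
          rcases hdeg e (by rw [hends1]; exact Sym2.mem_mk_right z z') with h | h
          · exact hef h
          · exact hef' h
        have hxz : Conn ends ω x z := by
          rcases hz with ⟨_, h⟩ | ⟨hzv', _⟩
          · exact h
          · exact absurd hzv' hzv
        exact Or.inl ⟨hz'v, conn_trans hxz (conn_of_openAdj ⟨e, he, hends1⟩)⟩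
  have hxS : x ∈ S := Or.inl ⟨hx, conn_refl ends ω x⟩
  rcases mem_of_conn_of_closed hS hxS h with ⟨_, h⟩ | ⟨hyv, _⟩
  · exact h
  · exact absurd hyv hy

/-- **On `{f' open}`, re-ending `f` from `v` to `w'` does not change the connections among the
vertices other than `v`.** -/
lemma conn_reend_iff {ω : Config E} (hf : ends f = s(v, w))
    (hf' : ends f' = s(v, w')) (hdeg : ∀ e, v ∈ ends e → e = f ∨ e = f') (hvw : v ≠ w)
    (hvw' : v ≠ w') (hω : ω f' = true) {x y : V} (hx : x ≠ v) (hy : y ≠ v) :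
    Conn ends ω x y ↔ Conn (Function.update ends f s(w, w')) ω x y :=
  ⟨conn_reend_of_conn hf hf' hdeg hvw hvw' hx hy, conn_of_conn_reend hf hf' hdeg hvw hvw' hω hx hy⟩

/-- On `{f' open}`, the cluster of `a₃ ≠ v` is the same in `ends` and in `ends[f ↦ {w, w'}]`. -/
lemma cluster_reend {ω : Config E} (hff : f ≠ f') (hf : ends f = s(v, w))
    (hf' : ends f' = s(v, w')) (hdeg : ∀ e, v ∈ ends e → e = f ∨ e = f') (hvw : v ≠ w)
    (hvw' : v ≠ w') (hω : ω f' = true) {a₃ : V} (h3 : a₃ ≠ v) :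
    cluster ends ω a₃ = cluster (Function.update ends f s(w, w')) ω a₃ := by
  have hf'' : (Function.update ends f s(w, w')) f' = s(v, w') := by
    rw [Function.update_of_ne hff.symm, hf']
  ext u
  simp only [mem_cluster]
  by_cases hu : u = v
  · rw [hu]
    have h1 : Conn ends ω v w' := conn_of_openAdj ⟨f', hω, hf'⟩
    have h2 : Conn (Function.update ends f s(w, w')) ω v w' := conn_of_openAdj ⟨f', hω, hf''⟩
    constructor
    · intro h
      exact conn_trans ((conn_reend_iff hf hf' hdeg hvw hvw' hω h3 hvw'.symm).1
        (conn_trans h h1)) (conn_symm h2)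
    · intro h
      exact conn_trans ((conn_reend_iff hf hf' hdeg hvw hvw' hω h3 hvw'.symm).2
        (conn_trans h h2)) (conn_symm h1)
  · exact conn_reend_iff hf hf' hdeg hvw hvw' hω h3 hu

end Reend

section ReendEvents

variable {V : Type*} {E : Type*} [DecidableEq E] {ends : E → Sym2 V} {v w w' : V} {f f' : E}

omit [DecidableEq E] in
/-- Two events that agree on `{f' open}` (pointwise) have the same intersection with it. -/
lemma inter_open_eq_of_iff {A B : Set (Config E)} (h : ∀ ω, ω f' = true → (ω ∈ A ↔ ω ∈ B)) :
    A ∩ openEdge f' = B ∩ openEdge f' := by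
  ext ω
  simp only [Set.mem_inter_iff, mem_openEdge]
  constructor
  · rintro ⟨hA, hω⟩; exact ⟨(h ω hω).1 hA, hω⟩
  · rintro ⟨hB, hω⟩; exact ⟨(h ω hω).2 hB, hω⟩

omit [DecidableEq E] in
/-- `f ∈ touches S` iff one of its ends lies in `S`. -/
lemma mem_touches_iff_of_ends (hf : ends f = s(v, w)) (S : Set V) :
    f ∈ touches ends S ↔ v ∈ S ∨ w ∈ S := by
  constructor
  · rintro ⟨x, hx, y, hxy⟩
    rw [hf, Sym2.eq_iff] at hxy
    rcases hxy with ⟨rfl, _⟩ | ⟨_, rfl⟩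
    · exact Or.inl hx
    · exact Or.inr hx
  · exact mem_touches_of_ends hf

variable [Fintype V] [DecidableEq V]

/-- **The residual connections agree on `{f' open}`** for every removed set `W` that contains `w'`
whenever it contains `v` (the only clusters of `a₃` that occur when `f'` is sure). -/
lemma connDelEvent_reend_inter_open (hf : ends f = s(v, w))
    (hf' : ends f' = s(v, w')) (hdeg : ∀ e, v ∈ ends e → e = f ∨ e = f') (hvw : v ≠ w)
    (hvw' : v ≠ w') {W : Finset V} (hW : v ∈ W → w' ∈ W) {x y : V} (hx : x ≠ v) (hy : y ≠ v) :
    connDelEvent ends W x y ∩ openEdge f' =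
      connDelEvent (Function.update ends f s(w, w')) W x y ∩ openEdge f' := by
  set ends' := Function.update ends f s(w, w') with hends'
  refine inter_open_eq_of_iff fun ω hω => ?_
  simp only [mem_connDelEvent]
  set ρ := restrict (touches ends (↑W : Set V))ᶜ ω with hρ
  set ρ' := restrict (touches ends' (↑W : Set V))ᶜ ω with hρ'
  -- off `f` the two residual configurations agree
  have hagree : ∀ e, e ≠ f → ρ e = ρ' e := by
    intro e hef
    have key : e ∈ touches ends' (↑W : Set V) ↔ e ∈ touches ends (↑W : Set V) := by
      simp only [touches, Set.mem_setOf_eq, hends', Function.update_of_ne hef]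
    by_cases hmem : e ∈ touches ends (↑W : Set V)
    · rw [hρ, hρ', restrict_apply_of_notMem (e := e) (by simpa using hmem),
        restrict_apply_of_notMem (e := e) (by simpa using key.2 hmem)]
    · rw [hρ, hρ', restrict_apply_of_mem (e := e) (by simpa using hmem),
        restrict_apply_of_mem (e := e) (by simpa using mt key.1 hmem)]
  have hfe : ends' f = s(w, w') := by rw [hends', Function.update_self]
  have hρf_false (h : v ∈ W ∨ w ∈ W) : ρ f = false :=
    restrict_apply_of_notMem (e := f) (by simpa using (mem_touches_iff_of_ends hf _).2 h)
  have hρf_eq (h : ¬ (v ∈ W ∨ w ∈ W)) : ρ f = ω f :=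
    restrict_apply_of_mem (e := f) (by simpa using mt (mem_touches_iff_of_ends hf _).1 h)
  have hρ'f_false (h : w ∈ W ∨ w' ∈ W) : ρ' f = false :=
    restrict_apply_of_notMem (e := f) (by simpa using (mem_touches_iff_of_ends hfe _).2 h)
  have hρ'f_eq (h : ¬ (w ∈ W ∨ w' ∈ W)) : ρ' f = ω f :=
    restrict_apply_of_mem (e := f) (by simpa using mt (mem_touches_iff_of_ends hfe _).1 h)
  have hρf'_false (h : v ∈ W ∨ w' ∈ W) : ρ f' = false :=
    restrict_apply_of_notMem (e := f') (by simpa using (mem_touches_iff_of_ends hf' _).2 h)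
  have hρf'_eq (h : ¬ (v ∈ W ∨ w' ∈ W)) : ρ f' = ω f' :=
    restrict_apply_of_mem (e := f') (by simpa using mt (mem_touches_iff_of_ends hf' _).1 h)
  -- the closed-`f` case: `ρ = ρ'` and re-ending is invisible
  have closed_case : ρ f = false → ρ' f = false → (Conn ends ρ x y ↔ Conn ends' ρ' x y) := by
    intro h1 h2
    have heq : ρ = ρ' := by
      funext e
      by_cases hef : e = f
      · rw [hef, h1, h2]
      · exact hagree e hef
    rw [heq]
    exact (conn_update_of_closed h2 s(w, w') x y).symm
  by_cases hv : v ∈ W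
  · exact closed_case (hρf_false (Or.inl hv)) (hρ'f_false (Or.inr (hW hv)))
  · by_cases hw : w ∈ W
    · exact closed_case (hρf_false (Or.inr hw)) (hρ'f_false (Or.inl hw))
    · by_cases hw' : w' ∈ W
      · -- `f'` is closed in both residuals: `v` is a leaf through `f` in `ρ`, isolated in `ρ'`
        have h2 : ρ' f = false := hρ'f_false (Or.inr hw')
        have hpair : Conn ends ρ x y ↔ Conn ends ρ' x y :=
          conn_pair_iff hf hf' hdeg hvw hvw' (fun e hef _ => hagree e hef)
            (by rw [hρf'_false (Or.inr hw'), h2]; simp) hx hy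
        rw [hpair]
        exact (conn_update_of_closed h2 s(w, w') x y).symm
      · -- nothing touches `v`: `ρ = ρ'` with `f'` open, the re-ending lemma
        have heq : ρ = ρ' := by
          funext e
          by_cases hef : e = f
          · rw [hef, hρf_eq (fun h => h.elim hv hw), hρ'f_eq (fun h => h.elim hw hw')]
          · exact hagree e hef
        have hρf'' : ρ f' = true := by rw [hρf'_eq (fun h => h.elim hv hw')]; exact hω
        rw [heq] at hρf'' ⊢
        exact conn_reend_iff hf hf' hdeg hvw hvw' hρf'' hx hy

/-- The residual `Q` agrees on `{f' open}`. -/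
lemma delQ_reend_inter_open (hf : ends f = s(v, w)) (hf' : ends f' = s(v, w'))
    (hdeg : ∀ e, v ∈ ends e → e = f ∨ e = f') (hvw : v ≠ w) (hvw' : v ≠ w') {W : Finset V}
    (hW : v ∈ W → w' ∈ W) {a₁ a₂ : V} (h1 : a₁ ≠ v) (h2 : a₂ ≠ v) :
    delQ ends W a₁ a₂ ∩ openEdge f' =
      delQ (Function.update ends f s(w, w')) W a₁ a₂ ∩ openEdge f' := by
  have h := connDelEvent_reend_inter_open hf hf' hdeg hvw hvw' hW h1 h2
  unfold delQ
  refine inter_open_eq_of_iff fun ω hω => ?_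
  simp only [Set.mem_compl_iff]
  constructor
  · intro hA hB
    have : ω ∈ connDelEvent (Function.update ends f s(w, w')) W a₁ a₂ ∩ openEdge f' := ⟨hB, hω⟩
    rw [← h] at this
    exact hA this.1
  · intro hB hA
    have : ω ∈ connDelEvent ends W a₁ a₂ ∩ openEdge f' := ⟨hA, hω⟩
    rw [h] at this
    exact hB this.1

end ReendEvents

end SeriesCollapse

end Summit.Ventures.PercRepro2
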